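import Summits.Schanuel.Schanuel.Theorems.RootDecomp1KHyper54

/-!
# RootDecomp1KHyper — lens 6, generation 17 «BILOG STAIRCASE CELL» (BilogStair.lean edition 2 f0528a77…, 2567 l) — continuation (RootDecomp1KHyper55): §D the member `zB = i·(π, ℓ₀, y_B)`, `ℓ₀ = arctan (4/3)`: §D.1 `HyperStair` for the member, §D.2 `Flat` for the member

(lens-6 g17 `BilogStair.lean` edition 2, sha256 f0528a77…5850, own farm rc 0 · 0 sorry · axioms std; critic ACK STATUS L1737 PORT GO LOW (registered, no credit);
port by census-1 gen 15 in ten parts `RootDecomp1KHyper53`–`62` — see the PORT NOTE of part 53; `--supports stmt-Schanuel-33363`; rung 0.)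
-/

open Complex Polynomial IntermediateField Filter
open scoped BigOperators

namespace Summit.Schanuel.Schanuel.Theorems.RootDecomp1KHyper

namespace HyperCell

namespace LatCell

namespace Bilog

/-! ## §D  The member `z_B = i·(π, ℓ₀, y_B)`, `ℓ₀ = arctan (4/3)` (so `e^{iℓ₀} = α₀ = (3+4i)/5`),
`y_B = π·y_ev + ℓ₀·y_od = π · yx (ℓ₀/π)` (the tree's lacunary binary pair `(y_ev, y_od)` of `RootDecomp1KHyper34`,
staircase approximants `a_k = P_k/2^{a_k}`, `b_k = M_k/2^{a_k}`). -/

/-- `ℓ₀ = arctan (4/3)`. -/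
noncomputable def ell : ℝ := Real.arctan (4 / 3)

/-- `τ₀ = ℓ₀ / π`. -/
noncomputable def tau : ℝ := ell / Real.pi

/-- The hyper-Liouville coordinate `y_B = π · yx τ₀ = π·y_ev + ℓ₀·y_od`. -/
noncomputable def yB : ℝ := Real.pi * yx tau

/-- The staircase approximants `a_k = P_k / 2^{a_k}`. -/
noncomputable def aB (k : ℕ) : ℚ := (pmP k : ℚ) / (2 : ℚ) ^ hexp k

/-- The staircase approximants `b_k = M_k / 2^{a_k}`. -/
noncomputable def bB (k : ℕ) : ℚ := (pmM k : ℚ) / (2 : ℚ) ^ hexp k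

/-- **The member** `z_B = (iπ, iℓ₀, i y_B)`. -/
noncomputable def zB : Fin 3 → ℂ := ![(Real.pi : ℂ) * I, (ell : ℂ) * I, (yB : ℂ) * I]

/-- `ℓ₀ = arctan(4/3) > 0`. -/
theorem ell_pos : 0 < ell := Real.arctan_pos.mpr (by norm_num)

/-- `ℓ₀ < π/2`. -/
theorem ell_lt : ell < Real.pi / 2 := Real.arctan_lt_pi_div_two _

/-- `τ = ℓ₀/π > 0`. -/
theorem tau_pos : 0 < tau := div_pos ell_pos Real.pi_pos

/-- `τ ≤ 3/2`. -/
theorem tau_le : tau ≤ 3 / 2 := by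
  unfold tau
  rw [div_le_iff₀ Real.pi_pos]
  linarith [ell_lt, Real.pi_pos]

/-- `ℓ₀ = τ · π`. -/
theorem ell_eq : ell = tau * Real.pi := by
  unfold tau; rw [div_mul_cancel₀ _ Real.pi_ne_zero]

/-- `e^{iℓ₀} = (3 + 4i)/5`. -/
theorem cexp_ell : cexp ((ell : ℂ) * I) = (3 + 4 * I) / 5 := by
  rw [Complex.exp_mul_I, ← Complex.ofReal_cos, ← Complex.ofReal_sin]
  unfold ell
  rw [Real.cos_arctan, Real.sin_arctan]
  have hs : Real.sqrt (1 + (4 / 3 : ℝ) ^ 2) = 5 / 3 := by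
    rw [show (1 : ℝ) + (4 / 3) ^ 2 = (5 / 3) ^ 2 by norm_num, Real.sqrt_sq (by norm_num)]
  rw [hs]
  push_cast
  ring

/-- `e^{iℓ₀}` is algebraic: a root of `5X² − 6X + 5`. -/
theorem isAlgebraic_cexp_ell : IsAlgebraic ℚ (cexp ((ell : ℂ) * I)) := by
  rw [cexp_ell]
  refine ⟨Polynomial.C 5 * X ^ 2 - Polynomial.C 6 * X + Polynomial.C 5, ?_, ?_⟩
  · intro h
    have := congrArg (Polynomial.eval 0) h
    simp at this
  · simp only [map_add, map_sub, map_mul, Polynomial.aeval_C, Polynomial.aeval_X_pow, Polynomial.aeval_X,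
      eq_ratCast]
    push_cast
    linear_combination (16 / 5 : ℂ) * I_sq

/-! ### §D.1  `HyperStair` for the member -/

/-- The `K`-th staircase approximant `a_K π + b_K ℓ₀` equals `π` times the `K`-th partial sum of `y_τ`. -/
theorem approx_eq (K : ℕ) :
    (aB K : ℝ) * Real.pi + (bB K : ℝ) * ell = Real.pi * ∑ k ∈ Finset.range (K + 1), ytx tau k := by
  rw [partialSum_ytx, ell_eq]
  unfold aB bB
  push_cast
  have h2 : (0 : ℝ) < 2 ^ hexp K := by positivity
  field_simp

/-- The `K`-th staircase error is `π` times the tail of `y_τ`. -/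
theorem err_eq (K : ℕ) :
    yB - ((aB K : ℝ) * Real.pi + (bB K : ℝ) * ell) = Real.pi * ∑' k, ytx tau (k + (K + 1)) := by
  rw [approx_eq, yB, yx_eq_partialSum_add_tail tau_pos.le tau_le (K + 1)]
  ring

/-- The staircase error is positive. -/
theorem err_pos (K : ℕ) : 0 < yB - ((aB K : ℝ) * Real.pi + (bB K : ℝ) * ell) := by
  rw [err_eq]; exact mul_pos Real.pi_pos (yx_tail_pos tau_pos tau_le _)

/-- The staircase error is at most `10 · 2^{-a_{K+1}}`. -/
theorem err_le (K : ℕ) :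
    yB - ((aB K : ℝ) * Real.pi + (bB K : ℝ) * ell) ≤ 10 * (1 / (2 : ℝ) ^ hexp (K + 1)) := by
  rw [err_eq]
  have hπ : Real.pi ≤ 10 / 3 := by linarith [Real.pi_lt_d2]
  calc Real.pi * ∑' k, ytx tau (k + (K + 1)) ≤ (10 / 3) * ((3 / 2) * (2 * (1 / (2 : ℝ) ^ hexp (K + 1)))) :=
        mul_le_mul hπ (yx_tail_le tau_pos.le tau_le (K + 1)) (yx_tail_pos tau_pos tau_le _).le (by norm_num)
    _ = 10 * (1 / (2 : ℝ) ^ hexp (K + 1)) := by ring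

/-- `M_K ≤ 2^{a_K}`. -/
theorem pmM_le_pow (K : ℕ) : pmM K ≤ 2 ^ hexp K := by
  have h := pmP_add_pmM_le_pow K
  have h1 : (1 : ℝ) ≤ pmP K := by exact_mod_cast one_le_pmP K
  have h2 : (pmM K : ℝ) ≤ 2 ^ hexp K := by linarith
  exact_mod_cast h2

/-- `P_K ≤ 2^{a_K}`. -/
theorem pmP_le_pow (K : ℕ) : pmP K ≤ 2 ^ hexp K := by
  have h := pmP_add_pmM_le_pow K
  have h1 : (0 : ℝ) ≤ pmM K := by positivity
  have h2 : (pmP K : ℝ) ≤ 2 ^ hexp K := by linarith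
  exact_mod_cast h2

/-- Denominator and numerator of `n / 2^{a_K}`. -/
theorem den_num_le (n K : ℕ) :
    ((((n : ℚ) / (2 : ℚ) ^ hexp K).den : ℤ) ≤ 2 ^ hexp K) ∧ |(((n : ℚ) / (2 : ℚ) ^ hexp K).num)| ≤ n := by
  have e : (n : ℚ) / (2 : ℚ) ^ hexp K = Rat.divInt (n : ℤ) ((2 : ℤ) ^ hexp K) := by
    rw [← Rat.intCast_div_eq_divInt]; push_cast; rfl
  rw [e]
  refine ⟨Int.le_of_dvd (by positivity) (Rat.den_dvd _ _), ?_⟩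
  rcases Nat.eq_zero_or_pos n with hn | hn
  · subst hn; simp
  · exact Int.le_of_dvd (by exact_mod_cast hn) ((abs_dvd _ _).mpr (Rat.num_dvd _ (by positivity)))

/-- Height bound of the member's staircase: `hgt ≤ 2^{a_K + 2}`. -/
theorem hgt_le (K : ℕ) : hgt aB bB K ≤ (2 : ℝ) ^ (hexp K + 2) := by
  obtain ⟨hd1, hn1⟩ := den_num_le (pmP K) K
  obtain ⟨hd2, hn2⟩ := den_num_le (pmM K) K
  unfold hgt aB bB
  have hd1' : (((pmP K : ℚ) / (2 : ℚ) ^ hexp K).den : ℝ) ≤ 2 ^ hexp K := by exact_mod_cast hd1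
  have hd2' : (((pmM K : ℚ) / (2 : ℚ) ^ hexp K).den : ℝ) ≤ 2 ^ hexp K := by exact_mod_cast hd2
  have hn1' : |((((pmP K : ℚ) / (2 : ℚ) ^ hexp K).num : ℝ))| ≤ pmP K := by
    rw [← Int.cast_abs]; exact_mod_cast hn1
  have hn2' : |((((pmM K : ℚ) / (2 : ℚ) ^ hexp K).num : ℝ))| ≤ pmM K := by
    rw [← Int.cast_abs]; exact_mod_cast hn2
  have hPM := pmP_add_pmM_le_pow K
  have h1 : (1 : ℝ) ≤ 2 ^ hexp K := one_le_pow₀ (by norm_num)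
  rw [pow_add]
  norm_num
  linarith

/-- `(1/3)^X ≤ exp(−X)`. -/
theorem third_pow_le_exp_neg (X : ℕ) : ((1 : ℝ) / 3) ^ X ≤ Real.exp (-(X : ℝ)) := by
  have h3 : Real.exp 1 ≤ 3 := by have := Real.exp_one_lt_d9; norm_num at this; linarith
  have h1 : (1 : ℝ) / 3 ≤ Real.exp (-1) := by
    rw [Real.exp_neg, ← one_div]
    exact one_div_le_one_div_of_le (Real.exp_pos 1) h3
  calc ((1 : ℝ) / 3) ^ X ≤ Real.exp (-1) ^ X := pow_le_pow_left₀ (by norm_num) h1 X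
    _ = Real.exp (-(X : ℝ)) := by rw [← Real.exp_nat_mul]; ring_nf

/-- `10 · 16^{−X} < 3^{−X}` for `X ≥ 2`. -/
theorem ten_mul_sixteenth_pow_lt {X : ℕ} (hX : 2 ≤ X) :
    10 * ((1 : ℝ) / 16) ^ X < ((1 : ℝ) / 3) ^ X := by
  have e : ((1 : ℝ) / 3) ^ X = ((16 : ℝ) / 3) ^ X * ((1 : ℝ) / 16) ^ X := by
    rw [← mul_pow]; norm_num
  rw [e]
  have h : (10 : ℝ) < ((16 : ℝ) / 3) ^ X :=
    calc (10 : ℝ) < ((16 : ℝ) / 3) ^ 2 := by norm_num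
      _ ≤ ((16 : ℝ) / 3) ^ X := pow_le_pow_right₀ (by norm_num) hX
  exact mul_lt_mul_of_pos_right h (by positivity)

/-- Core estimate: for `K ≥ 3(m+1)+3` and any height `1 ≤ H ≤ 2^{a_K + 2}`, the error is `< exp(−H^{m+1})`. -/
theorem err_lt_exp (m K : ℕ) (hK : 3 * (m + 1) + 3 ≤ K) {H : ℝ} (hH1 : 1 ≤ H)
    (hH : H ≤ (2 : ℝ) ^ (hexp K + 2)) :
    yB - ((aB K : ℝ) * Real.pi + (bB K : ℝ) * ell) < Real.exp (-H ^ (m + 1)) := by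
  set Y : ℕ := 2 ^ ((m + 1) * (hexp K + 2)) with hY
  have hY2 : 2 ≤ Y := by
    rw [hY]
    calc (2 : ℕ) = 2 ^ 1 := by norm_num
      _ ≤ 2 ^ ((m + 1) * (hexp K + 2)) := Nat.pow_le_pow_right (by norm_num) (by nlinarith [one_le_hexp K])
  have hX : H ^ (m + 1) ≤ (Y : ℝ) := by
    calc H ^ (m + 1) ≤ ((2 : ℝ) ^ (hexp K + 2)) ^ (m + 1) := pow_le_pow_left₀ (by linarith) hH _
      _ = (Y : ℝ) := by rw [hY]; push_cast; rw [← pow_mul, Nat.mul_comm]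
  have h4Y : 4 * Y ≤ hexp (K + 1) := by rw [hY]; exact four_mul_two_pow_le_hexp_succ (m + 1) K hK
  have hcmp : 1 / (2 : ℝ) ^ hexp (K + 1) ≤ 1 / (2 : ℝ) ^ (4 * Y) :=
    one_div_le_one_div_of_le (by positivity) (pow_le_pow_right₀ (by norm_num) h4Y)
  have e16 : (1 : ℝ) / (2 : ℝ) ^ (4 * Y) = ((1 : ℝ) / 16) ^ Y := by
    rw [pow_mul, one_div_pow]; norm_num
  calc yB - ((aB K : ℝ) * Real.pi + (bB K : ℝ) * ell) ≤ 10 * (1 / (2 : ℝ) ^ hexp (K + 1)) := err_le K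
    _ ≤ 10 * (1 / (2 : ℝ) ^ (4 * Y)) := by gcongr
    _ = 10 * ((1 : ℝ) / 16) ^ Y := by rw [e16]
    _ < ((1 : ℝ) / 3) ^ Y := ten_mul_sixteenth_pow_lt hY2
    _ ≤ Real.exp (-(Y : ℝ)) := third_pow_le_exp_neg Y
    _ ≤ Real.exp (-H ^ (m + 1)) := Real.exp_le_exp.mpr (neg_le_neg hX)

/-- The same with exponent `m`. -/
theorem err_lt_exp' (m K : ℕ) (hK : 3 * (m + 1) + 3 ≤ K) {H : ℝ} (hH1 : 1 ≤ H)
    (hH : H ≤ (2 : ℝ) ^ (hexp K + 2)) :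
    yB - ((aB K : ℝ) * Real.pi + (bB K : ℝ) * ell) < Real.exp (-H ^ m) :=
  (err_lt_exp m K hK hH1 hH).trans_le
    (Real.exp_le_exp.mpr (neg_le_neg (pow_le_pow_right₀ hH1 (Nat.le_succ m))))

/-- **`HyperStair` for the member**: `|y_B − (a_K π + b_K ℓ₀)| < exp(−H_K^m)` for all large `K`. -/
theorem hyperStair_B : HyperStair ell yB aB bB := by
  intro m
  filter_upwards [eventually_ge_atTop (3 * (m + 1) + 3)] with K hK
  rw [abs_of_pos (err_pos K)]
  exact err_lt_exp' m K hK (one_le_hgt _ _ _) (hgt_le K)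

/-- **`HyperLatApprox`** of `i y_B` from the lattice `ℤ iπ + ℤ iℓ₀` (explicit witnesses), hence
`HyperLinLiouville z_B`. -/
theorem hyperLatApprox_zB : HyperLatApprox ((Real.pi : ℂ) * I) ((ell : ℂ) * I) ((yB : ℂ) * I) := by
  intro m
  obtain ⟨K, hK⟩ : ∃ K : ℕ, K = 3 * (m + 1) + 3 := ⟨_, rfl⟩
  have hdiff : (yB : ℂ) * I - (((pmP K : ℤ) : ℂ) * ((Real.pi : ℂ) * I) + ((pmM K : ℤ) : ℂ) * ((ell : ℂ) * I)) /
      ((2 ^ hexp K : ℕ) : ℂ) = ((yB - ((aB K : ℝ) * Real.pi + (bB K : ℝ) * ell) : ℝ) : ℂ) * I := by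
    unfold aB bB
    push_cast
    field_simp
  have hpos := err_pos K
  refine ⟨(pmP K : ℤ), (pmM K : ℤ), 2 ^ hexp K, by positivity, ?_, ?_⟩
  · intro h
    have h0 : ((yB - ((aB K : ℝ) * Real.pi + (bB K : ℝ) * ell) : ℝ) : ℂ) * I = 0 := by
      rw [← hdiff, ← h, sub_self]
    rcases mul_eq_zero.mp h0 with h1 | h1
    · exact hpos.ne' (by exact_mod_cast h1)
    · exact I_ne_zero h1
  · rw [hdiff, norm_mul, Complex.norm_I, mul_one, Complex.norm_real, Real.norm_eq_abs, abs_of_pos hpos]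
    refine err_lt_exp' m K (by omega)
      (le_add_of_le_of_nonneg (le_add_of_le_of_nonneg (le_add_of_nonneg_right (by positivity))
        (abs_nonneg _)) (abs_nonneg _)) ?_
    have hPM := pmP_add_pmM_le_pow K
    have h1 : (1 : ℝ) ≤ 2 ^ hexp K := one_le_pow₀ (by norm_num)
    push_cast
    rw [Nat.abs_cast, Nat.abs_cast, pow_add]
    nlinarith

/-- `z_B` as a `latTriple`. -/
theorem zB_eq_latTriple : zB = latTriple ((Real.pi : ℂ) * I) ((ell : ℂ) * I) ((yB : ℂ) * I) := rfl

/-- **`z_B` is hyper-lin-Liouville** (hypothesis of the residual). -/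
theorem hyperLinLiouville_zB : HyperLinLiouville zB := by
  rw [zB_eq_latTriple]; exact hyperLinLiouville_latTriple hyperLatApprox_zB

/-! ### §D.2  `Flat` for the member (flatness along odd `K`) -/

/-- Even-part term at even index. -/
theorem evt_of_even {k : ℕ} (hk : Even k) : evt k = 1 / (2 : ℝ) ^ hexp k := by
  simp [evt, ytx, pwx_of_even _ hk]

/-- Even-part term vanishes at odd index. -/
theorem evt_of_odd {k : ℕ} (hk : ¬ Even k) : evt k = 0 := by
  simp [evt, ytx, pwx_of_not_even _ hk]

/-- Odd-part term vanishes at even index. -/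
theorem odt_of_even {k : ℕ} (hk : Even k) : odt k = 0 := by
  rw [odt, ytx_one, ← evt, evt_of_even hk, sub_self]

/-- Odd-part term at odd index. -/
theorem odt_of_odd {k : ℕ} (hk : ¬ Even k) : odt k = 1 / (2 : ℝ) ^ hexp k := by
  rw [odt, ytx_one, ← evt, evt_of_odd hk, sub_zero]

/-- Even-part terms are bounded by `2^{-a_k}`. -/
theorem evt_le (k : ℕ) : evt k ≤ 1 / (2 : ℝ) ^ hexp k := by
  have := evt_add_odt k; have := odt_nonneg k; linarith

/-- Odd-part terms are bounded by `2^{-a_k}`. -/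
theorem odt_le (k : ℕ) : odt k ≤ 1 / (2 : ℝ) ^ hexp k := by
  have := evt_add_odt k; have := evt_nonneg k; linarith

/-- Tail bound for the even part. -/
theorem evt_tail_le (K : ℕ) : ∑' k, evt (k + K) ≤ 2 * (1 / (2 : ℝ) ^ hexp K) := by
  have := evt_tail_add_odt_tail K; have := odt_tail_nonneg K; have := lambdaH_tail_le K; linarith

/-- Tail bound for the odd part. -/
theorem odt_tail_le (K : ℕ) : ∑' k, odt (k + K) ≤ 2 * (1 / (2 : ℝ) ^ hexp K) := by
  have := evt_tail_add_odt_tail K; have := evt_tail_nonneg K; have := lambdaH_tail_le K; linarith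

/-- `y⁰ − a_K` is the even-part tail. -/
theorem yev_sub_aB (K : ℕ) : yev - (aB K : ℝ) = ∑' k, evt (k + (K + 1)) := by
  rw [yev_eq_partialSum_add_tail (K + 1), partialSum_evt]
  unfold aB; push_cast; ring

/-- `y¹ − b_K` is the odd-part tail. -/
theorem yod_sub_bB (K : ℕ) : yod - (bB K : ℝ) = ∑' k, odt (k + (K + 1)) := by
  rw [yod_eq_partialSum_add_tail (K + 1), partialSum_odt]
  unfold bB; push_cast; ring

/-- Shifting an odd-part tail past a vanishing (even-indexed) term. -/
theorem odt_tail_shift {K : ℕ} (hK : Even (K + 1)) :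
    ∑' k, odt (k + (K + 1)) = ∑' k, odt (k + (K + 2)) := by
  rw [(summable_odt_tail (K + 1)).tsum_eq_zero_add, zero_add, odt_of_even hK, zero_add]
  exact tsum_congr fun k => by ring_nf

/-- **`Flat` for the member** (with `(Y₁, Y₂) = (y_ev, y_od)`), along odd `K`. -/
theorem flat_B : Flat aB bB yev yod := by
  intro M δ hδ
  obtain ⟨n, hn⟩ := exists_pow_lt_of_lt_one (half_pos hδ) (by norm_num : (1 : ℝ) / 2 < 1)
  refine Filter.frequently_atTop.mpr fun N => ⟨2 * (N + M + n) + 1, by omega, ?_⟩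
  set K := 2 * (N + M + n) + 1 with hKdef
  have hKe : Even (K + 1) := ⟨N + M + n + 1, by omega⟩
  have hKo : ¬ Even (K + 2) := by
    rw [Nat.not_even_iff_odd]; exact ⟨N + M + n + 1, by omega⟩
  rw [yev_sub_aB, yod_sub_bB, odt_tail_shift hKe]
  have hlow : 1 / (2 : ℝ) ^ hexp (K + 1) ≤ ∑' k, evt (k + (K + 1)) := by
    have h := (summable_evt_tail (K + 1)).le_tsum 0 (fun j _ => evt_nonneg _)
    rw [zero_add, evt_of_even hKe] at h
    exact h
  have hlow2 : 1 / (2 : ℝ) ^ hexp (K + 2) ≤ ∑' k, odt (k + (K + 2)) := by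
    have h := (summable_odt_tail (K + 2)).le_tsum 0 (fun j _ => odt_nonneg _)
    rw [zero_add, odt_of_odd hKo] at h
    exact h
  refine ⟨lt_of_lt_of_le (by positivity) hlow, ?_, lt_of_lt_of_le (by positivity) hlow2, ?_⟩
  · -- `u < δ`
    calc ∑' k, evt (k + (K + 1)) ≤ 2 * (1 / (2 : ℝ) ^ hexp (K + 1)) := evt_tail_le _
      _ ≤ 2 * ((1 : ℝ) / 2) ^ n := by
          rw [one_div_pow]
          gcongr
          · norm_num
          · calc n ≤ K + 1 := by omega
              _ ≤ hexp (K + 1) := hexp_strictMono.id_le _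
      _ < 2 * (δ / 2) := by gcongr
      _ = δ := by ring
  · -- flatness: `v ≤ u^M`
    calc ∑' k, odt (k + (K + 2)) ≤ 2 * (1 / (2 : ℝ) ^ hexp (K + 2)) := odt_tail_le _
      _ ≤ (1 / (2 : ℝ) ^ hexp (K + 1)) ^ M := by
          rw [one_div_pow, ← pow_mul, show (2 : ℝ) * (1 / 2 ^ hexp (K + 2)) = 1 / 2 ^ (hexp (K + 2) - 1) by
            have h1 := one_le_hexp (K + 2)
            rw [← pow_sub_mul_pow (2 : ℝ) h1, pow_one]
            field_simp]
          apply one_div_le_one_div_of_le (by positivity)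
          apply pow_le_pow_right₀ (by norm_num)
          -- `hexp (K+1) * M ≤ hexp (K+2) - 1`
          have h2 : hexp (K + 2) = 2 ^ ((K + 2) * hexp (K + 1)) := hexp_succ (K + 1)
          have h3 : (K + 2) * hexp (K + 1) < 2 ^ ((K + 2) * hexp (K + 1)) := Nat.lt_two_pow_self
          have h4 : hexp (K + 1) * M ≤ (K + 1) * hexp (K + 1) := by
            rw [Nat.mul_comm]; exact Nat.mul_le_mul_right _ (by omega)
          have h5 : (K + 1) * hexp (K + 1) + hexp (K + 1) = (K + 2) * hexp (K + 1) := by ring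
          have h6 := one_le_hexp (K + 1)
          omega
      _ ≤ (∑' k, evt (k + (K + 1))) ^ M := pow_le_pow_left₀ (by positivity) hlow M

end Bilog
end LatCell
end HyperCell
end Summit.Schanuel.Schanuel.Theorems.RootDecomp1KHyper
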